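import Summits.QuantumFields.YangMills.Theses.GronwallGap
import Summits.QuantumFields.YangMills.Theses.DirichletWindow
import Summits.QuantumFields.YangMills.Theses.ScalingWindowSplit
import Summits.QuantumFields.YangMills.Theorems.GronwallGapContinuumFromLatticeGapOneFieldLocal
import Summits.QuantumFields.YangMills.Theorems.GronwallGapContinuumFromLatticeGapStubLockOffE
import Summits.QuantumFields.YangMills.Theorems.GronwallGapContinuumFromLatticeGapStubCriticalOfLock
import Summits.QuantumFields.YangMills.Theorems.GronwallGapContinuumFromLatticeGapDockSWSGlue
import Summits.QuantumFields.YangMills.Theorems.GronwallGapContinuumFromLatticeGapDockSWS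
import Summits.QuantumFields.YangMills.Theorems.ConvexGribovBodyContinuumLegGivenGapStubRpCoreA
import Summits.QuantumFields.YangMills.Theorems.GronwallGapContinuumFromLatticeGapStubChordTwoCase
import Summits.QuantumFields.YangMills.Theorems.GronwallGapContinuumFromLatticeGapStubRpSeminorm
import Summits.QuantumFields.YangMills.Theorems.GronwallGapContinuumFromLatticeGapStubPairingDictionary
import Summits.QuantumFields.YangMills.Theorems.GronwallGapContinuumFromLatticeGapOneFieldUniform
import Summits.QuantumFields.YangMills.Theorems.GronwallGapContinuumFromLatticeGapStubMonomialConstants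
import Summits.QuantumFields.YangMills.Theorems.GronwallGapContinuumFromLatticeGapStubVolumeChoice
import Summits.QuantumFields.YangMills.Theorems.GronwallGapContinuumFromLatticeGapStubLawToCofinal
import Summits.QuantumFields.YangMills.Theorems.ContinuumFromLatticeGap.Negative.ColdPressureAtLockVersusLatticeLeg

/-!
# Line `registered` — skeleton for crux `ContinuumFromLatticeGap` (stmt-QuantumFields-15915), RESHAPE 7
(reshape 6: the RP-spectral conjunct (b) ELIMINATED — torus RP chord + Minkowski + UNIFORM monomial constants + cofinal
volumes; reshape 7: the datum-relative open stub replaced by the POINTWISE ONE-SCALE LAW plus a provable bridge;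
route `GronwallGap`, rank 4; sub-problem `YangMills`; published as `Cruxes/ContinuumFromLatticeGap/Lines/birth.lean`;
lead `prover-line-stmt-QuantumFields-15915-c4-0`, 2026-08-17; history: birth → reshape 1/1b → 2/2b (lead -0: IR leg
landed) → 3/4 (lead c1: dock on `ScalingWindowSplit`, cold pressure at the lock) → 5 (lead c2: LOCAL RP-spectral class)
→ 6 (lead c3: (b) eliminated, eleven files landed) → 7 (this file)).

## Why reshape 7 (lead c4)

Reshape 6 left ONE open stub, `stub_oneScaleCofinal`: ONE SCALE relative to a locked critical DATUM (sequences `β_k`,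
`m̂_k`, `S₁`, `K`, a subsequence `φ`, cofinal volumes, schemes).  Its content is pointwise in the coupling: at a single
`β`, a rate `m` that clusters every pair of local species on all large odd tori (UNIF₁) and is `K`-sharp (SHARP₁) is
pinned within the factor `K` to the optimal uniform rate, and what is asked is the floor ∧ window of the bare
truncated curvature two-point function at a unit `a` with `Δ₀ a ≤ m`, with ONE bump and constants uniform in `β`.
Reshape 7 registers exactly that — `stub_oneScaleLaw` (open; no sequences, no subsequence, no scheme record; the
promotable text) — and the bridge `stub_lawToCofinal : law → stub_oneScaleCofinal` (provable now, proved in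
`work/stubs/StubLawToCofinal.lean`, rc 0: `φ = id`, the law's unit where `β₀ ≤ β_k ∧ m̂_k ≤ m₀` — eventually all —
and `m̂_k/Δ₀` elsewhere, volumes from the law's cofinal set above `max (L₀ k) (S₁ k) ⌈a_k⁻²⌉₊`, polynomial growth with
`N = 1`, and `T u k` = the law's explicit covariance by unfolding `latticeSchwinger` at `n = 2, 1`).  The composition is
unchanged below `stub_oneScaleCofinal`, which is now a theorem of the line modulo the law.  What the law ENTAILS
(floor ∧ window ∧ pin ∧ UNIF₁ ⇒ `ξ(β) ≥ c (β / log β)^{1/p} / log β`: quantitative Chatterjee Pb 5.1) and why no existing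
item docks: `Cruxes/ContinuumFromLatticeGap/RESIDUAL-c4.md`.

## Why reshape 6

Reshape 5 left two open stubs of open-problem strength: `stub_oneScale` (W₁ (c) at the lock) and
`stub_rpSpectralLocalAtLock` (W₁ (b) over the LOCAL slab-box class at the lock: RELATIVE clustering of every bounded
local slab functional `Y` with a `Y`-UNIFORM thermal constant `C B²` — the `S₀`-uniform spectral gap of the torus
transfer matrices on locally generated states).  Consumer analysis: (b) is read by exactly one lemma, the decay leg
(`stub_decayOfRPSpectralLocal`), which instantiates `Y` with ONE functional per test datum — the renormalised smeared
plane-string `Y_k`.  For that functional the `Y`-uniform constant is not needed: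

* on the odd torus `2S+1`, reflection positivity makes `j ↦ K_j(Y) := corr(Y∘Θ, Y; j)` non-negative and LOG-CONVEX on
  `0 ≤ j ≤ S` and `Y ↦ K_j(Y)` a positive quadratic form with Cauchy–Schwarz — LANDED for Wilson's lattice gauge theory
  in the `latticeConnectedCorr` currency (`RpCoreA.corr_nonneg`, `RpCoreA.corr_logConvex`, `RpCoreA.corr_sq_le`,
  `rpCore_chordBound`, `stub_rpShift`; the RP core of stmt-QuantumFields-15828);
* the chord between `j = 0` and the far end `j = S = L_k` gives `K_j(Y_k) ≤ e^{−(Δ/2) a_k j} K_0(Y_k) + D_k e^{−(Δ/2) a_k L_k}`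
  whenever `K_{L_k}(Y_k) ≤ D_k e^{−Δ a_k L_k}` (`stub_chordTwoCase`) — no upper bound on `K_0` is used;
* Minkowski for the PSD form (`stub_rpSeminorm`) bounds the far value through the expansion of `Y_k` into plaquette
  MONOMIALS `∏_{l∈s} plane (q l) (y l)`: `√K_S(Y_k) ≤ Σ |coeff| √K_S(monomial)`, and the reflected diagonal pair of a
  monomial is a FIXED species pair, so UNIFORM — per pair, `k`-uniform, the landed output of the lock — bounds it; by
  finiteness of the geometries of arity `n` in a box of size `d` there is ONE constant `Cmono n d` (`stub_monomialConstants`);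
* `D_k ≤ poly(a_k⁻¹) · Cmono(n, ⌊ρ/a_k⌋ + 2)` and its growth is ABSORBED by the volumes: `L_k` is chosen (diagonally over
  the countably many `(n, ρ)`) with `(log Cmono(n, ⌊ρ/a_k⌋+2) + |log a_k|)/(a_k L_k) → 0` (`stub_volumeChoice`) — the
  line may do so because ONE SCALE chooses the volumes; this is the only change to the open stub: floor ∧ window are asked
  along SOME volume sequence above any prescribed one (`stub_oneScaleCofinal`, cofinal volumes; physically harmless: the
  bare two-point function at physical distance `O(1)` does not feel volumes `L_k ≫ ξ_k`);
* the decay-leg pairing (torus reflection `θ t = 1 − t` inside the lift) IS `latticeConnectedCorr` of the pair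
  `(F∘Θ, F)`, `F := Y ∘ configShift e₀` (`stub_pairingDictionary`).

So the decay leg `Decay (planeSum T) (Δ₀/2)` follows from UNIFORM alone, conjunct (b) disappears from the line, and the
ONLY open content is ONE SCALE.  Stubs after reshape 7 (9): `stub_oneScaleLaw` (open, IR, pointwise); `stub_lawToCofinal`
(bridge, LANDED p172854); `stub_chordTwoCase`, `stub_rpSeminorm`, `stub_pairingDictionary`,
`stub_monomialConstants`, `stub_volumeChoice`, `stub_clayOfUniformInequalities` (reshape 6, all LANDED); the reshape-6
stub `stub_oneScaleCofinal` is kept verbatim as the THEOREM `oneScaleCofinal_of_law`.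

Composition `ContinuumFromLatticeGap_of hXi hLaw hU hW₂ hA` concludes the route decl BY NAME and is sorry-free below the ONE
open reshape-7 stub (the bridge is LANDED, p172854; the six provable reshape-6 stubs are LANDED — p166228 p166651 p166852 p167144 p167340
p168721 — and used by name).  Named hypotheses = ledger items XiDiverges stmt-8941, U_R stmt-18014, W₂ᴳ stmt-18170,
CurvatureAmnesia stmt-16192.

## Disproof used / negatives

No `Disproof.lean` for this crux (2026-08-17T14:40Z).  Honoured: this crux's `Negative/ColdPressureAtLockVersusLatticeLeg`
(p157912) and W₁'s `GapAtCorrelationLength_false_of_LightFluxGroup` (p148067): reshape 6 quantifies over NO global or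
flux-sensitive functional — every clustering input is UNIFORM at a fixed local species pair, i.e. the crux's own
hypothesis currency; `Barriers.FixedCouplingUltralocality` (β ∘ φ → ∞, unit pinned to the locked rate from above).
-/

noncomputable section

namespace Summit.QuantumFields.YangMills.Cruxes.ContinuumFromLatticeGap.Registered

open scoped SchwartzMap BigOperators ComplexConjugate
open Filter Topology MeasureTheory
open Literature.MathematicalPhysics.QuantumFieldTheory Literature.MathematicalPhysics.QuantumLattice
  Literature.MathematicalPhysics.AQFT Literature.Probability.LatticeModels
open Summit.QuantumFields.YangMills.Theses
open Summit.QuantumFields.YangMills.Theorems.ContinuumLegGivenGap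
open Summit.QuantumFields.YangMills.Cruxes.HypercubicLimit.CouplingResponse
open Summit.QuantumFields.YangMills.Cruxes.OSLegsFromFemtoAndGap.DlrCollarTransfer (plane conn Decay)

/-! ## Stubs — landed ones imported by name, open ones and the reshape-6 pieces `:= by sorry` -/

/-- **Stub 1 — the IR lock OFF the exceptional set** (LANDED p147376, `stub_lockOffE`). -/
theorem lockOffE :
    DirichletWindow.XiDiverges →
    ∀ (G : Type) [Group G] [TopologicalSpace G] [IsTopologicalGroup G] [CompactSpace G]
      [MeasurableSpace G] [BorelSpace G], IsCompactSimpleLieGroup G → ∀ r : LatticeRep G,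
      (∃ E : Set ℝ, (∀ b : ℝ, (E ∩ Set.Icc 0 b).Finite) ∧ ∀ β : ℝ, 0 < β → β ∉ E → ∃ m : ℝ, 0 < m ∧
        ∀ A B : YMSpecies G, ∃ C : ℝ, ∃ S₀ : ℕ, ∀ S : ℕ, S₀ ≤ S → ∀ n : ℕ, n ≤ S →
          |latticeConnectedCorr r.ρ β (2 * S + 1) A.F B.F n| ≤ C * Real.exp (-(m * n))) →
      ∃ (β : ℕ → ℝ) (mh : ℕ → ℝ) (S₁ : ℕ → ℕ) (K : ℝ), Tendsto β atTop atTop ∧ (∀ k, 0 < mh k) ∧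
        0 < K ∧
        (∀ A B : YMSpecies G, ∃ C : ℝ, ∀ k S n : ℕ, S₁ k ≤ S → n ≤ S →
          |latticeConnectedCorr r.ρ (β k) (2 * S + 1) A.F B.F n| ≤ C * Real.exp (-(mh k * n))) ∧
        (∀ k S₀ : ℕ, ∃ A B : YMSpecies G, ∀ C : ℝ, ∃ S n : ℕ, S₀ ≤ S ∧ n ≤ S ∧
          C * Real.exp (-(K * mh k * n)) <
            |latticeConnectedCorr r.ρ (β k) (2 * S + 1) A.F B.F n|) :=
  Summit.QuantumFields.YangMills.Theorems.ContinuumFromLatticeGap.stub_lockOffE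

/-- **Stub 2 — criticality of locked rates, from the lock alone** (LANDED p147095, `stub_criticalOfLock`). -/
theorem criticalOfLock :
    DirichletWindow.XiDiverges →
    ∀ (G : Type) [Group G] [TopologicalSpace G] [IsTopologicalGroup G] [CompactSpace G]
      [MeasurableSpace G] [BorelSpace G], IsCompactSimpleLieGroup G → ∀ r : LatticeRep G,
      ∀ (β : ℕ → ℝ) (mh : ℕ → ℝ) (S₁ : ℕ → ℕ), Tendsto β atTop atTop → (∀ k, 0 < mh k) →
        (∀ A B : YMSpecies G, ∃ C : ℝ, ∀ k S n : ℕ, S₁ k ≤ S → n ≤ S →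
          |latticeConnectedCorr r.ρ (β k) (2 * S + 1) A.F B.F n| ≤ C * Real.exp (-(mh k * n))) →
        Tendsto mh atTop (𝓝 0) :=
  Summit.QuantumFields.YangMills.Theorems.ContinuumFromLatticeGap.stub_criticalOfLock

/-- **Stub 3″ — the POINTWISE ONE-SCALE LAW** (open; IR, lattice-only; reshape 7 of `stub_oneScaleCofinal`: no
sequences, no subsequence, no scheme record).  For every compact simple `G` some faithful `r` such that for every
sharpness `K > 0` there are ONE real bump `u` supported at negative times, `p`, `M`, `Δ₀ > 0`, `β₀` and `m₀ > 0` with: at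
every coupling `β ≥ β₀` and every rate `0 < m ≤ m₀` which (UNIF₁) clusters EVERY pair of local gauge-invariant species
in Euclidean time on all odd tori `2S+1 ≥ 2T₀+1` (one constant per pair) and (SHARP₁) is `K`-sharp beyond every size
(`K·m` is beaten by some pair) — so that `m_*(β)/K ≤ m ≤ m_*(β)` for the optimal uniform rate — there is a unit `a > 0`
with the PIN `Δ₀ a ≤ m` such that on a COFINAL set of odd tori the BARE truncated two-point function
`T⁰(w) = ⟨Φ(w)Φ(θw)⟩ − ⟨Φ(w)⟩⟨Φ(θw)⟩` of the smeared action density `Φ(w) = a⁴ Σ_{x ∈ box L} w(a x)·(Σ_{i<j} Re tr r.ρ(U_p))`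
(written through a universally quantified `T` with its defining equation) has the polynomial FLOOR `a ^ p ≤ T⁰(u)` and
the one-step WINDOW `T⁰(u) ≤ M·T⁰(τ₋₁u)`.  Content: dimensional transmutation at the bare level at ONE coupling at a
time — the plaquette channel is polynomially visible and one-scale at the unit of the optimal clustering rate; not
supplied by the lock; entails quantitative `ξ(β) → ∞` (RESIDUAL-c4.md §3). -/
theorem stub_oneScaleLaw :
    ∀ (G : Type) [Group G] [TopologicalSpace G] [IsTopologicalGroup G] [CompactSpace G]
      [MeasurableSpace G] [BorelSpace G], IsCompactSimpleLieGroup G → ∃ r : LatticeRep G, ∀ K : ℝ, 0 < K →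
      ∃ (u : 𝓢(EuclideanSpace ℝ (Fin 4), ℝ)) (p : ℕ) (M Δ₀ β₀ m₀ : ℝ),
        tsupport u ⊆ {y : EuclideanSpace ℝ (Fin 4) | y 0 < 0} ∧ 0 < Δ₀ ∧ 0 < m₀ ∧
        ∀ (β m : ℝ) (T₀ : ℕ), β₀ ≤ β → 0 < m → m ≤ m₀ →
          (∀ A B : YMSpecies G, ∃ C : ℝ, ∀ S n : ℕ, T₀ ≤ S → n ≤ S →
            |latticeConnectedCorr r.ρ β (2 * S + 1) A.F B.F n| ≤ C * Real.exp (-(m * n))) →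
          (∀ S₀ : ℕ, ∃ A B : YMSpecies G, ∀ C : ℝ, ∃ S n : ℕ, S₀ ≤ S ∧ n ≤ S ∧
            C * Real.exp (-(K * m * n)) < |latticeConnectedCorr r.ρ β (2 * S + 1) A.F B.F n|) →
          ∃ a : ℝ, 0 < a ∧ Δ₀ * a ≤ m ∧ ∀ L₁ : ℕ, ∃ L : ℕ, L₁ ≤ L ∧
            ∀ T : 𝓢(EuclideanSpace ℝ (Fin 4), ℝ) → ℝ,
              (∀ w, T w =
                (∫ U, smearedLatticeField r.curvature.F (box 4 L) a 1 0 w (torusLift (2 * L + 1) U) *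
                    smearedLatticeField r.curvature.F (box 4 L) a 1 0 (thetaTest 4 w) (torusLift (2 * L + 1) U)
                  ∂(wilsonMeasure r.ρ β : Measure (GaugeConfig 4 (2 * L + 1) G))) -
                (∫ U, smearedLatticeField r.curvature.F (box 4 L) a 1 0 w (torusLift (2 * L + 1) U)
                  ∂(wilsonMeasure r.ρ β : Measure (GaugeConfig 4 (2 * L + 1) G))) *
                (∫ U, smearedLatticeField r.curvature.F (box 4 L) a 1 0 (thetaTest 4 w) (torusLift (2 * L + 1) U)
                  ∂(wilsonMeasure r.ρ β : Measure (GaugeConfig 4 (2 * L + 1) G)))) →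
              a ^ p ≤ T u ∧ T u ≤ M * T (timeShiftTest 4 (-1) u) := by
  sorry

/-- **Stub 10 — the bridge: the pointwise law implies ONE SCALE at the lock with cofinal volumes** (reshape 7;
provable now, size S; LANDED p172854 as
`Theorems/GronwallGapContinuumFromLatticeGapStubLawToCofinal.lean`).  Along a locked critical datum take `φ = id`, the
law's unit at the indices where `β₀ ≤ β k ∧ m̂ k ≤ m₀` (eventually all: `β → ∞`, `m̂ → 0`) and `m̂ k / Δ₀` elsewhere (so
the pin holds everywhere), UNIF₁/SHARP₁ at index `k` = UNIFORM/SHARP read at `k`, volumes from the law's cofinal set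
above `max (L₀ k) (max (S₁ k) ⌈(a k)⁻¹ ^ 2⌉₊)` (hence `L ≥ L₀`, `L ≥ S₁`, polynomial growth with `N = 1`), and identify
`T u k` (the bare scheme's `latticeSchwinger` at `n = 2, 1`) with the law's explicit covariance (`Fin.prod_univ_succ`). [folklore] -/
theorem stub_lawToCofinal :
    (∀ (G : Type) [Group G] [TopologicalSpace G] [IsTopologicalGroup G] [CompactSpace G]
      [MeasurableSpace G] [BorelSpace G], IsCompactSimpleLieGroup G → ∃ r : LatticeRep G, ∀ K : ℝ, 0 < K →
      ∃ (u : 𝓢(EuclideanSpace ℝ (Fin 4), ℝ)) (p : ℕ) (M Δ₀ β₀ m₀ : ℝ),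
        tsupport u ⊆ {y : EuclideanSpace ℝ (Fin 4) | y 0 < 0} ∧ 0 < Δ₀ ∧ 0 < m₀ ∧
        ∀ (β m : ℝ) (T₀ : ℕ), β₀ ≤ β → 0 < m → m ≤ m₀ →
          (∀ A B : YMSpecies G, ∃ C : ℝ, ∀ S n : ℕ, T₀ ≤ S → n ≤ S →
            |latticeConnectedCorr r.ρ β (2 * S + 1) A.F B.F n| ≤ C * Real.exp (-(m * n))) →
          (∀ S₀ : ℕ, ∃ A B : YMSpecies G, ∀ C : ℝ, ∃ S n : ℕ, S₀ ≤ S ∧ n ≤ S ∧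
            C * Real.exp (-(K * m * n)) < |latticeConnectedCorr r.ρ β (2 * S + 1) A.F B.F n|) →
          ∃ a : ℝ, 0 < a ∧ Δ₀ * a ≤ m ∧ ∀ L₁ : ℕ, ∃ L : ℕ, L₁ ≤ L ∧
            ∀ T : 𝓢(EuclideanSpace ℝ (Fin 4), ℝ) → ℝ,
              (∀ w, T w =
                (∫ U, smearedLatticeField r.curvature.F (box 4 L) a 1 0 w (torusLift (2 * L + 1) U) *
                    smearedLatticeField r.curvature.F (box 4 L) a 1 0 (thetaTest 4 w) (torusLift (2 * L + 1) U)
                  ∂(wilsonMeasure r.ρ β : Measure (GaugeConfig 4 (2 * L + 1) G))) -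
                (∫ U, smearedLatticeField r.curvature.F (box 4 L) a 1 0 w (torusLift (2 * L + 1) U)
                  ∂(wilsonMeasure r.ρ β : Measure (GaugeConfig 4 (2 * L + 1) G))) *
                (∫ U, smearedLatticeField r.curvature.F (box 4 L) a 1 0 (thetaTest 4 w) (torusLift (2 * L + 1) U)
                  ∂(wilsonMeasure r.ρ β : Measure (GaugeConfig 4 (2 * L + 1) G)))) →
              a ^ p ≤ T u ∧ T u ≤ M * T (timeShiftTest 4 (-1) u)) →
    ∀ (G : Type) [Group G] [TopologicalSpace G] [IsTopologicalGroup G] [CompactSpace G]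
      [MeasurableSpace G] [BorelSpace G], IsCompactSimpleLieGroup G → ∃ r : LatticeRep G,
      ∀ (β : ℕ → ℝ) (mh : ℕ → ℝ) (S₁ : ℕ → ℕ) (K : ℝ), Tendsto β atTop atTop → (∀ k, 0 < mh k) → 0 < K →
      (∀ A B : YMSpecies G, ∃ C : ℝ, ∀ k S n : ℕ, S₁ k ≤ S → n ≤ S →
        |latticeConnectedCorr r.ρ (β k) (2 * S + 1) A.F B.F n| ≤ C * Real.exp (-(mh k * n))) →
      (∀ k S₀ : ℕ, ∃ A B : YMSpecies G, ∀ C : ℝ, ∃ S n : ℕ, S₀ ≤ S ∧ n ≤ S ∧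
        C * Real.exp (-(K * mh k * n)) < |latticeConnectedCorr r.ρ (β k) (2 * S + 1) A.F B.F n|) →
      Tendsto mh atTop (𝓝 0) →
      ∃ (a : ℕ → ℝ) (φ : ℕ → ℕ) (Δ₀ : ℝ), (∀ k, 0 < a k) ∧ StrictMono φ ∧ 0 < Δ₀ ∧ (∀ k, Δ₀ * a k ≤ mh (φ k)) ∧
        ∀ L₀ : ℕ → ℕ, ∃ (L : ℕ → ℕ) (u : 𝓢(EuclideanSpace ℝ (Fin 4), ℝ)) (p : ℕ) (M : ℝ),
          (∀ k, L₀ k ≤ L k) ∧ (∀ k, S₁ (φ k) ≤ L k) ∧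
          (∃ N : ℕ, 1 ≤ N ∧ ∀ᶠ k in atTop, (a k)⁻¹ ≤ (a k * (L k : ℝ)) ^ N) ∧
          tsupport u ⊆ {y : EuclideanSpace ℝ (Fin 4) | y 0 < 0} ∧
          ∀ sch : SpeciesScheme (YMSpecies G), (∀ k, sch.a k = a k) → (∀ k, sch.β k = β (φ k)) →
            (∀ k, sch.L k = L k) → ∀ T : 𝓢(EuclideanSpace ℝ (Fin 4), ℝ) → ℕ → ℝ,
            (∀ w k, T w k =
              latticeSchwinger r.ρ (SpeciesScheme.mk sch.a sch.a_pos sch.tendsto_a sch.β sch.L sch.tendsto_L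
                (fun _ _ => 1) (fun _ _ => 0)) (fun s => s.F) k (1 + 1) (fun _ => r.curvature) ![w, thetaTest 4 w] -
              latticeSchwinger r.ρ (SpeciesScheme.mk sch.a sch.a_pos sch.tendsto_a sch.β sch.L sch.tendsto_L
                (fun _ _ => 1) (fun _ _ => 0)) (fun s => s.F) k 1 (fun _ => r.curvature) ![w] *
              latticeSchwinger r.ρ (SpeciesScheme.mk sch.a sch.a_pos sch.tendsto_a sch.β sch.L sch.tendsto_L
                (fun _ _ => 1) (fun _ _ => 0)) (fun s => s.F) k 1 (fun _ => r.curvature) ![thetaTest 4 w]) →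
            ∀ᶠ k in atTop, (sch.a k) ^ p ≤ T u k ∧ T u k ≤ M * T (timeShiftTest 4 (-1) u) k :=
  -- LANDED p172854: Theorems/GronwallGapContinuumFromLatticeGapStubLawToCofinal.lean
  Summit.QuantumFields.YangMills.Theorems.ContinuumFromLatticeGap.stub_lawToCofinal

/-- **Stub 4 — the two-case log-convex chord** (reshape 6; pure real analysis, size S).  A non-negative sequence on
`0, …, N` (`N > 0`), log-convex at every interior index, with far value `g N ≤ D e^{−μN}` (`D > 0`) satisfies, for
every `0 ≤ μ' ≤ μ`, `g n ≤ e^{−μ' n} g 0 + D e^{−(μ−μ')N}` for all `n ≤ N` (chord through the end values; case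
`g 0 ≥ D e^{−(μ−μ')N}` gives the first term, the other case the second; from `rpCore_chordBound` applied to `g / g 0`,
resp. `g / (D e^{−(μ−μ')N})`, with `B = 1`). [folklore] -/
theorem stub_chordTwoCase :
    ∀ (g : ℕ → ℝ) (N : ℕ) (D μ μ' : ℝ), 0 < N → 0 < D → 0 ≤ μ' → μ' ≤ μ →
      (∀ n : ℕ, n ≤ N → 0 ≤ g n) →
      (∀ n : ℕ, 1 ≤ n → n + 1 ≤ N → g n ^ 2 ≤ g (n - 1) * g (n + 1)) →
      g N ≤ D * Real.exp (-(μ * N)) →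
      ∀ n : ℕ, n ≤ N → g n ≤ Real.exp (-(μ' * n)) * g 0 + D * Real.exp (-((μ - μ') * N)) :=
  -- LANDED p166228: Theorems/GronwallGapContinuumFromLatticeGapStubChordTwoCase.lean
  Summit.QuantumFields.YangMills.Theorems.ContinuumFromLatticeGap.stub_chordTwoCase

/-- **Stub 5 — Minkowski for the reflected diagonal form on the odd torus** (reshape 6; size M).  For finitely many
real bounded measurable cylinder observables `F i` of `ℤ⁴` supported on links based at times `0 ≤ x₀ ≤ w`, on the odd
torus `2S+1` with `S ≥ 2w+8` at `β ≥ 0`, and real coefficients `c i`: for every `m ≤ S`,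
`√corr((Σ cᵢFᵢ)∘Θ, Σ cᵢFᵢ; m) ≤ Σ |cᵢ| √corr(Fᵢ∘Θ, Fᵢ; m)` (`Θ = gaugeTimeReflect`, `corr = latticeConnectedCorr`):
expand bilinearly and bound each cross term by `RpCoreA.corr_sq_le` (Cauchy–Schwarz of the bond/site RP forms,
`RpCoreA.corr_nonneg`). [folklore] -/
theorem stub_rpSeminorm :
    ∀ (G : Type) [Group G] [TopologicalSpace G] [IsTopologicalGroup G] [CompactSpace G]
      [MeasurableSpace G] [BorelSpace G] (r : LatticeRep G) (β : ℝ), 0 ≤ β → ∀ (S w : ℕ), 2 * w + 8 ≤ S →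
      ∀ (ι : Type) (s : Finset ι) (F : ι → LGConfig 4 G → ℝ) (c : ι → ℝ)
        (Λ : ι → Finset (Literature.MathematicalPhysics.QuantumLattice.ZdEdge 4)),
      (∀ i ∈ s, Measurable (F i)) → (∀ i ∈ s, ∃ C : ℝ, ∀ U, |F i U| ≤ C) → (∀ i ∈ s, IsCylinder (F i) (Λ i)) →
      (∀ i ∈ s, ∀ e ∈ Λ i, 0 ≤ e.1 0 ∧ e.1 0 ≤ (w : ℤ)) → ∀ m : ℕ, m ≤ S →
        Real.sqrt (latticeConnectedCorr r.ρ β (2 * S + 1) ((fun U => ∑ i ∈ s, c i * F i U) ∘ gaugeTimeReflect)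
            (fun U => ∑ i ∈ s, c i * F i U) m) ≤
          ∑ i ∈ s, |c i| * Real.sqrt (latticeConnectedCorr r.ρ β (2 * S + 1) (F i ∘ gaugeTimeReflect) (F i) m) :=
  -- LANDED p166651: Theorems/GronwallGapContinuumFromLatticeGapStubRpSeminorm.lean
  Summit.QuantumFields.YangMills.Theorems.ContinuumFromLatticeGap.stub_rpSeminorm

/-- **Stub 6 — the pairing dictionary** (reshape 6; size M).  The decay leg's reflected pairing on the odd torus — the
torus reflection `θ t = 1 − t` INSIDE the periodic lift, the second copy time-translated by `j` — minus the squared mean is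
`latticeConnectedCorr` of the pair `(F∘Θ, F)` with `F := Y ∘ configShift e₀` and `Θ = gaugeTimeReflect` (the `ℤ⁴` bond
reflection in `x₀ = −1/2`) at separation `j` (`Reconstructible.gaugeTimeReflect_torusLift`, `configShift_torusLift`,
`rpShift_integral_shift_pair`, translation and reflection invariance of the torus Wilson state). [folklore] -/
theorem stub_pairingDictionary :
    ∀ (G : Type) [Group G] [TopologicalSpace G] [IsTopologicalGroup G] [CompactSpace G]
      [MeasurableSpace G] [BorelSpace G] (r : LatticeRep G) (β : ℝ) (S : ℕ) (Y : LGConfig 4 G → ℝ),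
      Measurable Y → (∃ C : ℝ, ∀ U, |Y U| ≤ C) → ∀ j : ℕ,
        (∫ U, Y (torusLift (2 * S + 1) (GaugeConfig.timeReflect U)) *
              Y (configShift (-Pi.single 0 (j : ℤ)) (torusLift (2 * S + 1) U))
            ∂(wilsonMeasure r.ρ β : Measure (GaugeConfig 4 (2 * S + 1) G))) -
          (∫ U, Y (torusLift (2 * S + 1) U) ∂(wilsonMeasure r.ρ β : Measure (GaugeConfig 4 (2 * S + 1) G))) ^ 2 =
        latticeConnectedCorr r.ρ β (2 * S + 1)
          ((Y ∘ configShift (Pi.single 0 1)) ∘ gaugeTimeReflect) (Y ∘ configShift (Pi.single 0 1)) j :=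
  -- LANDED p166852: Theorems/GronwallGapContinuumFromLatticeGapStubPairingDictionary.lean
  Summit.QuantumFields.YangMills.Theorems.ContinuumFromLatticeGap.stub_pairingDictionary

/-- **Stub 7 — UNIFORM monomial constants** (reshape 6; size M).  From UNIFORM (one constant per PAIR of local
gauge-invariant species, for all `k`, tori `S ≥ S₁ k`, `n ≤ S`) there is ONE constant `Cmono n d ≥ 1` per arity `n` and box
size `d` bounding the reflected diagonal clustering of every plaquette MONOMIAL `∏_{l∈s} plane (q l) (y l)` (`s ⊆ Fin n`,
sites `y l` with `0 ≤ y_l⁰ ≤ d`, `|y_lⁱ| ≤ d`): each monomial and its reflection `∘ gaugeTimeReflect` are species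
(products / reflections of translated plaquettes: `IsCylinder.mul`, `obsGeometry_isZdGaugeInvariant_comp_gaugeTimeReflect`),
UNIFORM gives a constant per geometry, and the geometries `(q, y, s)` of arity `n` in the box are finitely many. [folklore] -/
theorem stub_monomialConstants :
    ∀ (G : Type) [Group G] [TopologicalSpace G] [IsTopologicalGroup G] [CompactSpace G]
      [MeasurableSpace G] [BorelSpace G] (r : LatticeRep G) (β mh : ℕ → ℝ) (S₁ : ℕ → ℕ),
      (∀ A B : YMSpecies G, ∃ C : ℝ, ∀ k S n : ℕ, S₁ k ≤ S → n ≤ S →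
        |latticeConnectedCorr r.ρ (β k) (2 * S + 1) A.F B.F n| ≤ C * Real.exp (-(mh k * n))) →
      ∃ Cmono : ℕ → ℕ → ℝ, (∀ n d, 1 ≤ Cmono n d) ∧
        ∀ (n d : ℕ) (q : Fin n → Fin 4 × Fin 4) (y : Fin n → Site 4),
          (∀ l, (0 ≤ y l 0 ∧ y l 0 ≤ (d : ℤ)) ∧ ∀ i : Fin 4, i ≠ 0 → |y l i| ≤ (d : ℤ)) →
          ∀ (s : Finset (Fin n)) (k S j : ℕ), S₁ k ≤ S → j ≤ S →
            |latticeConnectedCorr r.ρ (β k) (2 * S + 1)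
                ((fun V => ∏ l ∈ s, plane G r (q l) (y l) V) ∘ gaugeTimeReflect)
                (fun V => ∏ l ∈ s, plane G r (q l) (y l) V) j| ≤ Cmono n d * Real.exp (-(mh k * j)) :=
  -- LANDED p167144: Theorems/GronwallGapContinuumFromLatticeGapStubMonomialConstants.lean
  Summit.QuantumFields.YangMills.Theorems.ContinuumFromLatticeGap.stub_monomialConstants

/-- **Stub 8 — the volume choice** (reshape 6; pure real analysis, size S).  Given spacings `a_k > 0`, `a_k → 0`, a
threshold sequence `T` and constants `C n d`, there is a volume floor `L₀` such that EVERY `L ≥ L₀` dominates `T`, has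
polynomial growth (`a_k⁻¹ ≤ (a_k L_k)^N` eventually), and absorbs the constants at every arity and radius:
`(log (max 1 (C n (⌊ρ/a_k⌋ + 2))) + |log a_k|)/(a_k L_k) → 0` for all `n, ρ : ℕ` (diagonal choice:
`a_k L₀ k ≥ (k+1)·(1 + |log a_k| + max_{n,ρ ≤ k} log⁺ C n (⌊ρ/a_k⌋+2))` and `L₀ k ≥ a_k⁻²`, `L₀ ≥ T`). [folklore] -/
theorem stub_volumeChoice :
    ∀ (a : ℕ → ℝ) (T : ℕ → ℕ) (C : ℕ → ℕ → ℝ), (∀ k, 0 < a k) → Tendsto a atTop (𝓝 0) →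
      ∃ L₀ : ℕ → ℕ, ∀ L : ℕ → ℕ, (∀ k, L₀ k ≤ L k) →
        (∀ k, T k ≤ L k) ∧ (∃ N : ℕ, 1 ≤ N ∧ ∀ᶠ k in atTop, (a k)⁻¹ ≤ (a k * (L k : ℝ)) ^ N) ∧
        ∀ n ρ : ℕ, Tendsto (fun k => (Real.log (max 1 (C n (⌊(ρ : ℝ) / a k⌋₊ + 2))) + |Real.log (a k)|) /
          (a k * (L k : ℝ))) atTop (𝓝 0) :=
  -- LANDED p167340: Theorems/GronwallGapContinuumFromLatticeGapStubVolumeChoice.lean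
  Summit.QuantumFields.YangMills.Theorems.ContinuumFromLatticeGap.stub_volumeChoice

/-- **Stub 9 — anchor: the dock's core over the UNIFORM-monomial hypotheses** (reshape 6; the twin of the landed
`stub_clayOfLocalInequalities` (p161399) with the LOCAL RP-spectral clause REPLACED by the monomial clustering constants
along the scheme and their absorption by the volumes; size L: new decay leg `decay_of_uniformMonomials` (torus RP chord +
Minkowski + dictionary) and the closure / seam / dock twins of the reshape-5 files; lands as
`Theorems/GronwallGapContinuumFromLatticeGapDockUniform.lean`): the Clay `G`-clause from the lattice inequalities at ONE
witness. [cite: GlimmJaffe1987, §6.1 and §19.1] -/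
theorem stub_clayOfUniformInequalities :
    ∀ (G : Type) [Group G] [TopologicalSpace G] [IsTopologicalGroup G] [CompactSpace G] [MeasurableSpace G]
      [BorelSpace G], IsCompactSimpleLieGroup G → ScalingWindowSplit.SelfNormalisedMomentBoundsR →
      ScalingWindowSplit.SelfNormalisedSkewnessGapped → CoincidenceRotationBootstrap.CurvatureAmnesia →
      ∀ (r : LatticeRep G) (sch : SpeciesScheme (YMSpecies G)) (u : 𝓢(EuclideanSpace ℝ (Fin 4), ℝ)) (p : ℕ) (M Δ : ℝ)
      (Cmono : ℕ → ℕ → ℝ) (T : 𝓢(EuclideanSpace ℝ (Fin 4), ℝ) → ℕ → ℝ),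
      (∀ w k, T w k = latticeSchwinger r.ρ (SpeciesScheme.mk sch.a sch.a_pos sch.tendsto_a sch.β sch.L sch.tendsto_L (fun _ _ => 1) (fun _ _ => 0))
          (fun s => s.F) k (1 + 1) (fun _ => r.curvature) ![w, thetaTest 4 w] -
        latticeSchwinger r.ρ (SpeciesScheme.mk sch.a sch.a_pos sch.tendsto_a sch.β sch.L sch.tendsto_L (fun _ _ => 1) (fun _ _ => 0))
          (fun s => s.F) k 1 (fun _ => r.curvature) ![w] *
        latticeSchwinger r.ρ (SpeciesScheme.mk sch.a sch.a_pos sch.tendsto_a sch.β sch.L sch.tendsto_L (fun _ _ => 1) (fun _ _ => 0))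
          (fun s => s.F) k 1 (fun _ => r.curvature) ![thetaTest 4 w]) →
      sch.HasWeakCouplingLimit → (∃ N : ℕ, 1 ≤ N ∧ ∀ᶠ k in atTop, (sch.a k)⁻¹ ≤ (sch.a k * (sch.L k : ℝ)) ^ N) →
      0 < Δ → HasLatticeMassGap r sch Δ → (∀ n d, 1 ≤ Cmono n d) →
      (∀ (n d : ℕ) (q : Fin n → Fin 4 × Fin 4) (y : Fin n → Site 4),
        (∀ l, (0 ≤ y l 0 ∧ y l 0 ≤ (d : ℤ)) ∧ ∀ i : Fin 4, i ≠ 0 → |y l i| ≤ (d : ℤ)) →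
        ∀ (s : Finset (Fin n)) (k j : ℕ), j ≤ sch.L k →
          latticeConnectedCorr r.ρ (sch.β k) (2 * sch.L k + 1)
              ((fun V => ∏ l ∈ s, plane G r (q l) (y l) V) ∘ gaugeTimeReflect)
              (fun V => ∏ l ∈ s, plane G r (q l) (y l) V) j ≤ Cmono n d * Real.exp (-(Δ * sch.a k * j))) →
      (∀ n ρ : ℕ, Tendsto (fun k => (Real.log (Cmono n (⌊(ρ : ℝ) / sch.a k⌋₊ + 2)) + |Real.log (sch.a k)|) /
          (sch.a k * (sch.L k : ℝ))) atTop (𝓝 0)) →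
      tsupport u ⊆ {y : EuclideanSpace ℝ (Fin 4) | y 0 < 0} →
      (∀ᶠ k in atTop, (sch.a k) ^ p ≤ T u k ∧ T u k ≤ M * T (timeShiftTest 4 (-1) u) k) →
      ∃ (r : LatticeRep G) (sch : SpeciesScheme (YMSpecies G)) (T : OSData (YMSpecies G) 4),
        sch.HasWeakCouplingLimit ∧ IsYangMillsFor r sch T ∧ T.IsNontrivial r.curvature ∧
          T.IsNonGaussian r.curvature ∧ ∃ Δ > 0, T.HasMassGap Δ ∧ HasLatticeMassGap r sch Δ := by
  -- LANDED (p168721) as Summit.QuantumFields.YangMills.Theorems.ContinuumFromLatticeGap.stub_clayOfUniformInequalities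
  -- (Theorems/GronwallGapContinuumFromLatticeGapDockUniform.lean); its proof is repeated here verbatim over the landed seam
  -- `oneField_of_latticeInequalities_uniform` (p168612) so that this workfile elaborates before the farm has built the dock module.
  intro G _ _ _ _ _ _ hG hU hW₂ hA r sch u p M Δ Cmono T hT hw hpv hΔ hGAP hC1 hmono habs hu hfw
  obtain rfl : T = fun w k => latticeSchwinger r.ρ (SpeciesScheme.mk sch.a sch.a_pos sch.tendsto_a sch.β sch.L sch.tendsto_L (fun _ _ => 1) (fun _ _ => 0))
          (fun s => s.F) k (1 + 1) (fun _ => r.curvature) ![w, thetaTest 4 w] -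
        latticeSchwinger r.ρ (SpeciesScheme.mk sch.a sch.a_pos sch.tendsto_a sch.β sch.L sch.tendsto_L (fun _ _ => 1) (fun _ _ => 0))
          (fun s => s.F) k 1 (fun _ => r.curvature) ![w] *
        latticeSchwinger r.ρ (SpeciesScheme.mk sch.a sch.a_pos sch.tendsto_a sch.β sch.L sch.tendsto_L (fun _ _ => 1) (fun _ _ => 0))
          (fun s => s.F) k 1 (fun _ => r.curvature) ![thetaTest 4 w] := funext fun w => funext fun k => hT w k
  have hm : ‹MeasurableSpace G› = borel G := BorelSpace.measurable_eq
  subst hm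
  letI : MeasurableSpace G := borel G
  haveI : BorelSpace G := ⟨rfl⟩
  obtain ⟨sch', S₁', hw', h₁⟩ :=
    Summit.QuantumFields.YangMills.Theorems.ContinuumFromLatticeGap.oneField_of_latticeInequalities_uniform r sch u p M Δ
      Cmono hw hpv hΔ hGAP hC1 hmono habs hu hfw (hU G r sch u p M hw hpv hu hfw) (hW₂ G r sch u p M Δ hw hΔ hGAP hpv hu hfw)
  exact Summit.QuantumFields.YangMills.Theorems.ContinuumFromLatticeGap.concl_of_hypercubicAt hA hG
    (Summit.QuantumFields.YangMills.Theorems.ContinuumFromLatticeGap.hypercubicAt_of_oneField r sch' S₁' hw' h₁)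

/-- **Anchor of the glue files: the pinned unit tends to zero** (LANDED p154366, `stub_unitToZero`). -/
theorem unitToZero : ∀ (a mh : ℕ → ℝ) (φ : ℕ → ℕ) (Δ₀ : ℝ), (∀ k, 0 < a k) → StrictMono φ → 0 < Δ₀ →
    (∀ k, Δ₀ * a k ≤ mh (φ k)) → Tendsto mh atTop (𝓝 0) → Tendsto a atTop (𝓝 0) :=
  Summit.QuantumFields.YangMills.Theorems.ContinuumFromLatticeGap.stub_unitToZero

/-- **Anchor of the dock file: the BARE scheme record on locked data** (LANDED p155657, `stub_bareScheme`). -/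
theorem bareScheme : ∀ (G : Type) [Group G] [MeasurableSpace G] (a b : ℕ → ℝ) (L : ℕ → ℕ),
    (∀ k, 0 < a k) → Tendsto a atTop (𝓝 0) → Tendsto (fun k => a k * (L k : ℝ)) atTop atTop →
    ∃ sch : SpeciesScheme (YMSpecies G), (∀ k, sch.a k = a k) ∧ (∀ k, sch.β k = b k) ∧ (∀ k, sch.L k = L k) ∧
      (∀ s k, sch.c s k = 1) ∧ (∀ s k, sch.m s k = 0) :=
  Summit.QuantumFields.YangMills.Theorems.ContinuumFromLatticeGap.stub_bareScheme

/-! ## Name-keyed aliases of the stub statements (hypotheses of `ContinuumFromLatticeGap_of`) -/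
namespace __Registered

/-- Statement of `stub_oneScaleLaw` (reshape 7, open), keyed by the stub name. -/
abbrev stub_oneScaleLaw : Prop :=
    ∀ (G : Type) [Group G] [TopologicalSpace G] [IsTopologicalGroup G] [CompactSpace G]
      [MeasurableSpace G] [BorelSpace G], IsCompactSimpleLieGroup G → ∃ r : LatticeRep G, ∀ K : ℝ, 0 < K →
      ∃ (u : 𝓢(EuclideanSpace ℝ (Fin 4), ℝ)) (p : ℕ) (M Δ₀ β₀ m₀ : ℝ),
        tsupport u ⊆ {y : EuclideanSpace ℝ (Fin 4) | y 0 < 0} ∧ 0 < Δ₀ ∧ 0 < m₀ ∧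
        ∀ (β m : ℝ) (T₀ : ℕ), β₀ ≤ β → 0 < m → m ≤ m₀ →
          (∀ A B : YMSpecies G, ∃ C : ℝ, ∀ S n : ℕ, T₀ ≤ S → n ≤ S →
            |latticeConnectedCorr r.ρ β (2 * S + 1) A.F B.F n| ≤ C * Real.exp (-(m * n))) →
          (∀ S₀ : ℕ, ∃ A B : YMSpecies G, ∀ C : ℝ, ∃ S n : ℕ, S₀ ≤ S ∧ n ≤ S ∧
            C * Real.exp (-(K * m * n)) < |latticeConnectedCorr r.ρ β (2 * S + 1) A.F B.F n|) →
          ∃ a : ℝ, 0 < a ∧ Δ₀ * a ≤ m ∧ ∀ L₁ : ℕ, ∃ L : ℕ, L₁ ≤ L ∧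
            ∀ T : 𝓢(EuclideanSpace ℝ (Fin 4), ℝ) → ℝ,
              (∀ w, T w =
                (∫ U, smearedLatticeField r.curvature.F (box 4 L) a 1 0 w (torusLift (2 * L + 1) U) *
                    smearedLatticeField r.curvature.F (box 4 L) a 1 0 (thetaTest 4 w) (torusLift (2 * L + 1) U)
                  ∂(wilsonMeasure r.ρ β : Measure (GaugeConfig 4 (2 * L + 1) G))) -
                (∫ U, smearedLatticeField r.curvature.F (box 4 L) a 1 0 w (torusLift (2 * L + 1) U)
                  ∂(wilsonMeasure r.ρ β : Measure (GaugeConfig 4 (2 * L + 1) G))) *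
                (∫ U, smearedLatticeField r.curvature.F (box 4 L) a 1 0 (thetaTest 4 w) (torusLift (2 * L + 1) U)
                  ∂(wilsonMeasure r.ρ β : Measure (GaugeConfig 4 (2 * L + 1) G)))) →
              a ^ p ≤ T u ∧ T u ≤ M * T (timeShiftTest 4 (-1) u)

/-- Statement of `stub_lawToCofinal` (reshape 7, bridge), keyed by the stub name. -/
abbrev stub_lawToCofinal : Prop :=
    (∀ (G : Type) [Group G] [TopologicalSpace G] [IsTopologicalGroup G] [CompactSpace G]
      [MeasurableSpace G] [BorelSpace G], IsCompactSimpleLieGroup G → ∃ r : LatticeRep G, ∀ K : ℝ, 0 < K →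
      ∃ (u : 𝓢(EuclideanSpace ℝ (Fin 4), ℝ)) (p : ℕ) (M Δ₀ β₀ m₀ : ℝ),
        tsupport u ⊆ {y : EuclideanSpace ℝ (Fin 4) | y 0 < 0} ∧ 0 < Δ₀ ∧ 0 < m₀ ∧
        ∀ (β m : ℝ) (T₀ : ℕ), β₀ ≤ β → 0 < m → m ≤ m₀ →
          (∀ A B : YMSpecies G, ∃ C : ℝ, ∀ S n : ℕ, T₀ ≤ S → n ≤ S →
            |latticeConnectedCorr r.ρ β (2 * S + 1) A.F B.F n| ≤ C * Real.exp (-(m * n))) →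
          (∀ S₀ : ℕ, ∃ A B : YMSpecies G, ∀ C : ℝ, ∃ S n : ℕ, S₀ ≤ S ∧ n ≤ S ∧
            C * Real.exp (-(K * m * n)) < |latticeConnectedCorr r.ρ β (2 * S + 1) A.F B.F n|) →
          ∃ a : ℝ, 0 < a ∧ Δ₀ * a ≤ m ∧ ∀ L₁ : ℕ, ∃ L : ℕ, L₁ ≤ L ∧
            ∀ T : 𝓢(EuclideanSpace ℝ (Fin 4), ℝ) → ℝ,
              (∀ w, T w =
                (∫ U, smearedLatticeField r.curvature.F (box 4 L) a 1 0 w (torusLift (2 * L + 1) U) *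
                    smearedLatticeField r.curvature.F (box 4 L) a 1 0 (thetaTest 4 w) (torusLift (2 * L + 1) U)
                  ∂(wilsonMeasure r.ρ β : Measure (GaugeConfig 4 (2 * L + 1) G))) -
                (∫ U, smearedLatticeField r.curvature.F (box 4 L) a 1 0 w (torusLift (2 * L + 1) U)
                  ∂(wilsonMeasure r.ρ β : Measure (GaugeConfig 4 (2 * L + 1) G))) *
                (∫ U, smearedLatticeField r.curvature.F (box 4 L) a 1 0 (thetaTest 4 w) (torusLift (2 * L + 1) U)
                  ∂(wilsonMeasure r.ρ β : Measure (GaugeConfig 4 (2 * L + 1) G)))) →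
              a ^ p ≤ T u ∧ T u ≤ M * T (timeShiftTest 4 (-1) u)) →
    ∀ (G : Type) [Group G] [TopologicalSpace G] [IsTopologicalGroup G] [CompactSpace G]
      [MeasurableSpace G] [BorelSpace G], IsCompactSimpleLieGroup G → ∃ r : LatticeRep G,
      ∀ (β : ℕ → ℝ) (mh : ℕ → ℝ) (S₁ : ℕ → ℕ) (K : ℝ), Tendsto β atTop atTop → (∀ k, 0 < mh k) → 0 < K →
      (∀ A B : YMSpecies G, ∃ C : ℝ, ∀ k S n : ℕ, S₁ k ≤ S → n ≤ S →
        |latticeConnectedCorr r.ρ (β k) (2 * S + 1) A.F B.F n| ≤ C * Real.exp (-(mh k * n))) →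
      (∀ k S₀ : ℕ, ∃ A B : YMSpecies G, ∀ C : ℝ, ∃ S n : ℕ, S₀ ≤ S ∧ n ≤ S ∧
        C * Real.exp (-(K * mh k * n)) < |latticeConnectedCorr r.ρ (β k) (2 * S + 1) A.F B.F n|) →
      Tendsto mh atTop (𝓝 0) →
      ∃ (a : ℕ → ℝ) (φ : ℕ → ℕ) (Δ₀ : ℝ), (∀ k, 0 < a k) ∧ StrictMono φ ∧ 0 < Δ₀ ∧ (∀ k, Δ₀ * a k ≤ mh (φ k)) ∧
        ∀ L₀ : ℕ → ℕ, ∃ (L : ℕ → ℕ) (u : 𝓢(EuclideanSpace ℝ (Fin 4), ℝ)) (p : ℕ) (M : ℝ),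
          (∀ k, L₀ k ≤ L k) ∧ (∀ k, S₁ (φ k) ≤ L k) ∧
          (∃ N : ℕ, 1 ≤ N ∧ ∀ᶠ k in atTop, (a k)⁻¹ ≤ (a k * (L k : ℝ)) ^ N) ∧
          tsupport u ⊆ {y : EuclideanSpace ℝ (Fin 4) | y 0 < 0} ∧
          ∀ sch : SpeciesScheme (YMSpecies G), (∀ k, sch.a k = a k) → (∀ k, sch.β k = β (φ k)) →
            (∀ k, sch.L k = L k) → ∀ T : 𝓢(EuclideanSpace ℝ (Fin 4), ℝ) → ℕ → ℝ,
            (∀ w k, T w k =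
              latticeSchwinger r.ρ (SpeciesScheme.mk sch.a sch.a_pos sch.tendsto_a sch.β sch.L sch.tendsto_L
                (fun _ _ => 1) (fun _ _ => 0)) (fun s => s.F) k (1 + 1) (fun _ => r.curvature) ![w, thetaTest 4 w] -
              latticeSchwinger r.ρ (SpeciesScheme.mk sch.a sch.a_pos sch.tendsto_a sch.β sch.L sch.tendsto_L
                (fun _ _ => 1) (fun _ _ => 0)) (fun s => s.F) k 1 (fun _ => r.curvature) ![w] *
              latticeSchwinger r.ρ (SpeciesScheme.mk sch.a sch.a_pos sch.tendsto_a sch.β sch.L sch.tendsto_L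
                (fun _ _ => 1) (fun _ _ => 0)) (fun s => s.F) k 1 (fun _ => r.curvature) ![thetaTest 4 w]) →
            ∀ᶠ k in atTop, (sch.a k) ^ p ≤ T u k ∧ T u k ≤ M * T (timeShiftTest 4 (-1) u) k

/-- Statement of the reshape-6 stub `stub_oneScaleCofinal` (now a theorem of the line modulo the law), keyed by its name. -/
abbrev stub_oneScaleCofinal : Prop :=
    ∀ (G : Type) [Group G] [TopologicalSpace G] [IsTopologicalGroup G] [CompactSpace G]
      [MeasurableSpace G] [BorelSpace G], IsCompactSimpleLieGroup G → ∃ r : LatticeRep G,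
      ∀ (β : ℕ → ℝ) (mh : ℕ → ℝ) (S₁ : ℕ → ℕ) (K : ℝ), Tendsto β atTop atTop → (∀ k, 0 < mh k) → 0 < K →
      (∀ A B : YMSpecies G, ∃ C : ℝ, ∀ k S n : ℕ, S₁ k ≤ S → n ≤ S →
        |latticeConnectedCorr r.ρ (β k) (2 * S + 1) A.F B.F n| ≤ C * Real.exp (-(mh k * n))) →
      (∀ k S₀ : ℕ, ∃ A B : YMSpecies G, ∀ C : ℝ, ∃ S n : ℕ, S₀ ≤ S ∧ n ≤ S ∧
        C * Real.exp (-(K * mh k * n)) < |latticeConnectedCorr r.ρ (β k) (2 * S + 1) A.F B.F n|) →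
      Tendsto mh atTop (𝓝 0) →
      ∃ (a : ℕ → ℝ) (φ : ℕ → ℕ) (Δ₀ : ℝ), (∀ k, 0 < a k) ∧ StrictMono φ ∧ 0 < Δ₀ ∧ (∀ k, Δ₀ * a k ≤ mh (φ k)) ∧
        ∀ L₀ : ℕ → ℕ, ∃ (L : ℕ → ℕ) (u : 𝓢(EuclideanSpace ℝ (Fin 4), ℝ)) (p : ℕ) (M : ℝ),
          (∀ k, L₀ k ≤ L k) ∧ (∀ k, S₁ (φ k) ≤ L k) ∧
          (∃ N : ℕ, 1 ≤ N ∧ ∀ᶠ k in atTop, (a k)⁻¹ ≤ (a k * (L k : ℝ)) ^ N) ∧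
          tsupport u ⊆ {y : EuclideanSpace ℝ (Fin 4) | y 0 < 0} ∧
          ∀ sch : SpeciesScheme (YMSpecies G), (∀ k, sch.a k = a k) → (∀ k, sch.β k = β (φ k)) →
            (∀ k, sch.L k = L k) → ∀ T : 𝓢(EuclideanSpace ℝ (Fin 4), ℝ) → ℕ → ℝ,
            (∀ w k, T w k =
              latticeSchwinger r.ρ (SpeciesScheme.mk sch.a sch.a_pos sch.tendsto_a sch.β sch.L sch.tendsto_L
                (fun _ _ => 1) (fun _ _ => 0)) (fun s => s.F) k (1 + 1) (fun _ => r.curvature) ![w, thetaTest 4 w] -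
              latticeSchwinger r.ρ (SpeciesScheme.mk sch.a sch.a_pos sch.tendsto_a sch.β sch.L sch.tendsto_L
                (fun _ _ => 1) (fun _ _ => 0)) (fun s => s.F) k 1 (fun _ => r.curvature) ![w] *
              latticeSchwinger r.ρ (SpeciesScheme.mk sch.a sch.a_pos sch.tendsto_a sch.β sch.L sch.tendsto_L
                (fun _ _ => 1) (fun _ _ => 0)) (fun s => s.F) k 1 (fun _ => r.curvature) ![thetaTest 4 w]) →
            ∀ᶠ k in atTop, (sch.a k) ^ p ≤ T u k ∧ T u k ≤ M * T (timeShiftTest 4 (-1) u) k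

/-- Statement of `stub_chordTwoCase`, keyed by the stub name. -/
abbrev stub_chordTwoCase : Prop :=
    ∀ (g : ℕ → ℝ) (N : ℕ) (D μ μ' : ℝ), 0 < N → 0 < D → 0 ≤ μ' → μ' ≤ μ →
      (∀ n : ℕ, n ≤ N → 0 ≤ g n) →
      (∀ n : ℕ, 1 ≤ n → n + 1 ≤ N → g n ^ 2 ≤ g (n - 1) * g (n + 1)) →
      g N ≤ D * Real.exp (-(μ * N)) →
      ∀ n : ℕ, n ≤ N → g n ≤ Real.exp (-(μ' * n)) * g 0 + D * Real.exp (-((μ - μ') * N))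

/-- Statement of `stub_rpSeminorm`, keyed by the stub name. -/
abbrev stub_rpSeminorm : Prop :=
    ∀ (G : Type) [Group G] [TopologicalSpace G] [IsTopologicalGroup G] [CompactSpace G]
      [MeasurableSpace G] [BorelSpace G] (r : LatticeRep G) (β : ℝ), 0 ≤ β → ∀ (S w : ℕ), 2 * w + 8 ≤ S →
      ∀ (ι : Type) (s : Finset ι) (F : ι → LGConfig 4 G → ℝ) (c : ι → ℝ)
        (Λ : ι → Finset (Literature.MathematicalPhysics.QuantumLattice.ZdEdge 4)),
      (∀ i ∈ s, Measurable (F i)) → (∀ i ∈ s, ∃ C : ℝ, ∀ U, |F i U| ≤ C) → (∀ i ∈ s, IsCylinder (F i) (Λ i)) →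
      (∀ i ∈ s, ∀ e ∈ Λ i, 0 ≤ e.1 0 ∧ e.1 0 ≤ (w : ℤ)) → ∀ m : ℕ, m ≤ S →
        Real.sqrt (latticeConnectedCorr r.ρ β (2 * S + 1) ((fun U => ∑ i ∈ s, c i * F i U) ∘ gaugeTimeReflect)
            (fun U => ∑ i ∈ s, c i * F i U) m) ≤
          ∑ i ∈ s, |c i| * Real.sqrt (latticeConnectedCorr r.ρ β (2 * S + 1) (F i ∘ gaugeTimeReflect) (F i) m)

/-- Statement of `stub_pairingDictionary`, keyed by the stub name. -/
abbrev stub_pairingDictionary : Prop :=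
    ∀ (G : Type) [Group G] [TopologicalSpace G] [IsTopologicalGroup G] [CompactSpace G]
      [MeasurableSpace G] [BorelSpace G] (r : LatticeRep G) (β : ℝ) (S : ℕ) (Y : LGConfig 4 G → ℝ),
      Measurable Y → (∃ C : ℝ, ∀ U, |Y U| ≤ C) → ∀ j : ℕ,
        (∫ U, Y (torusLift (2 * S + 1) (GaugeConfig.timeReflect U)) *
              Y (configShift (-Pi.single 0 (j : ℤ)) (torusLift (2 * S + 1) U))
            ∂(wilsonMeasure r.ρ β : Measure (GaugeConfig 4 (2 * S + 1) G))) -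
          (∫ U, Y (torusLift (2 * S + 1) U) ∂(wilsonMeasure r.ρ β : Measure (GaugeConfig 4 (2 * S + 1) G))) ^ 2 =
        latticeConnectedCorr r.ρ β (2 * S + 1)
          ((Y ∘ configShift (Pi.single 0 1)) ∘ gaugeTimeReflect) (Y ∘ configShift (Pi.single 0 1)) j

/-- Statement of `stub_monomialConstants`, keyed by the stub name. -/
abbrev stub_monomialConstants : Prop :=
    ∀ (G : Type) [Group G] [TopologicalSpace G] [IsTopologicalGroup G] [CompactSpace G]
      [MeasurableSpace G] [BorelSpace G] (r : LatticeRep G) (β mh : ℕ → ℝ) (S₁ : ℕ → ℕ),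
      (∀ A B : YMSpecies G, ∃ C : ℝ, ∀ k S n : ℕ, S₁ k ≤ S → n ≤ S →
        |latticeConnectedCorr r.ρ (β k) (2 * S + 1) A.F B.F n| ≤ C * Real.exp (-(mh k * n))) →
      ∃ Cmono : ℕ → ℕ → ℝ, (∀ n d, 1 ≤ Cmono n d) ∧
        ∀ (n d : ℕ) (q : Fin n → Fin 4 × Fin 4) (y : Fin n → Site 4),
          (∀ l, (0 ≤ y l 0 ∧ y l 0 ≤ (d : ℤ)) ∧ ∀ i : Fin 4, i ≠ 0 → |y l i| ≤ (d : ℤ)) →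
          ∀ (s : Finset (Fin n)) (k S j : ℕ), S₁ k ≤ S → j ≤ S →
            |latticeConnectedCorr r.ρ (β k) (2 * S + 1)
                ((fun V => ∏ l ∈ s, plane G r (q l) (y l) V) ∘ gaugeTimeReflect)
                (fun V => ∏ l ∈ s, plane G r (q l) (y l) V) j| ≤ Cmono n d * Real.exp (-(mh k * j))

/-- Statement of `stub_volumeChoice`, keyed by the stub name. -/
abbrev stub_volumeChoice : Prop :=
    ∀ (a : ℕ → ℝ) (T : ℕ → ℕ) (C : ℕ → ℕ → ℝ), (∀ k, 0 < a k) → Tendsto a atTop (𝓝 0) →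
      ∃ L₀ : ℕ → ℕ, ∀ L : ℕ → ℕ, (∀ k, L₀ k ≤ L k) →
        (∀ k, T k ≤ L k) ∧ (∃ N : ℕ, 1 ≤ N ∧ ∀ᶠ k in atTop, (a k)⁻¹ ≤ (a k * (L k : ℝ)) ^ N) ∧
        ∀ n ρ : ℕ, Tendsto (fun k => (Real.log (max 1 (C n (⌊(ρ : ℝ) / a k⌋₊ + 2))) + |Real.log (a k)|) /
          (a k * (L k : ℝ))) atTop (𝓝 0)

/-- Statement of `stub_clayOfUniformInequalities` (reshape-6 dock anchor), keyed by the stub name. -/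
abbrev stub_clayOfUniformInequalities : Prop :=
    ∀ (G : Type) [Group G] [TopologicalSpace G] [IsTopologicalGroup G] [CompactSpace G] [MeasurableSpace G]
      [BorelSpace G], IsCompactSimpleLieGroup G → ScalingWindowSplit.SelfNormalisedMomentBoundsR →
      ScalingWindowSplit.SelfNormalisedSkewnessGapped → CoincidenceRotationBootstrap.CurvatureAmnesia →
      ∀ (r : LatticeRep G) (sch : SpeciesScheme (YMSpecies G)) (u : 𝓢(EuclideanSpace ℝ (Fin 4), ℝ)) (p : ℕ) (M Δ : ℝ)
      (Cmono : ℕ → ℕ → ℝ) (T : 𝓢(EuclideanSpace ℝ (Fin 4), ℝ) → ℕ → ℝ),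
      (∀ w k, T w k = latticeSchwinger r.ρ (SpeciesScheme.mk sch.a sch.a_pos sch.tendsto_a sch.β sch.L sch.tendsto_L (fun _ _ => 1) (fun _ _ => 0))
          (fun s => s.F) k (1 + 1) (fun _ => r.curvature) ![w, thetaTest 4 w] -
        latticeSchwinger r.ρ (SpeciesScheme.mk sch.a sch.a_pos sch.tendsto_a sch.β sch.L sch.tendsto_L (fun _ _ => 1) (fun _ _ => 0))
          (fun s => s.F) k 1 (fun _ => r.curvature) ![w] *
        latticeSchwinger r.ρ (SpeciesScheme.mk sch.a sch.a_pos sch.tendsto_a sch.β sch.L sch.tendsto_L (fun _ _ => 1) (fun _ _ => 0))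
          (fun s => s.F) k 1 (fun _ => r.curvature) ![thetaTest 4 w]) →
      sch.HasWeakCouplingLimit → (∃ N : ℕ, 1 ≤ N ∧ ∀ᶠ k in atTop, (sch.a k)⁻¹ ≤ (sch.a k * (sch.L k : ℝ)) ^ N) →
      0 < Δ → HasLatticeMassGap r sch Δ → (∀ n d, 1 ≤ Cmono n d) →
      (∀ (n d : ℕ) (q : Fin n → Fin 4 × Fin 4) (y : Fin n → Site 4),
        (∀ l, (0 ≤ y l 0 ∧ y l 0 ≤ (d : ℤ)) ∧ ∀ i : Fin 4, i ≠ 0 → |y l i| ≤ (d : ℤ)) →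
        ∀ (s : Finset (Fin n)) (k j : ℕ), j ≤ sch.L k →
          latticeConnectedCorr r.ρ (sch.β k) (2 * sch.L k + 1)
              ((fun V => ∏ l ∈ s, plane G r (q l) (y l) V) ∘ gaugeTimeReflect)
              (fun V => ∏ l ∈ s, plane G r (q l) (y l) V) j ≤ Cmono n d * Real.exp (-(Δ * sch.a k * j))) →
      (∀ n ρ : ℕ, Tendsto (fun k => (Real.log (Cmono n (⌊(ρ : ℝ) / sch.a k⌋₊ + 2)) + |Real.log (sch.a k)|) /
          (sch.a k * (sch.L k : ℝ))) atTop (𝓝 0)) →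
      tsupport u ⊆ {y : EuclideanSpace ℝ (Fin 4) | y 0 < 0} →
      (∀ᶠ k in atTop, (sch.a k) ^ p ≤ T u k ∧ T u k ≤ M * T (timeShiftTest 4 (-1) u) k) →
      ∃ (r : LatticeRep G) (sch : SpeciesScheme (YMSpecies G)) (T : OSData (YMSpecies G) 4),
        sch.HasWeakCouplingLimit ∧ IsYangMillsFor r sch T ∧ T.IsNontrivial r.curvature ∧
          T.IsNonGaussian r.curvature ∧ ∃ Δ > 0, T.HasMassGap Δ ∧ HasLatticeMassGap r sch Δ
end __Registered

/-- **ONE SCALE at the lock, COFINAL VOLUMES** — the reshape-6 stub `stub_oneScaleCofinal`, verbatim — is a THEOREM of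
the line modulo the pointwise law (reshape 7): the bridge applied to the law. -/
theorem oneScaleCofinal_of_law (hLaw : __Registered.stub_oneScaleLaw) (hBridge : __Registered.stub_lawToCofinal) :
    __Registered.stub_oneScaleCofinal :=
  hBridge hLaw

/-! ## Composition: the crux BY NAME from the stub statements, `XiDiverges` and the filed items of `ScalingWindowSplit` -/

/-- **`ContinuumFromLatticeGap_of`** (reshape 7: the pointwise ONE-SCALE LAW is the only stub hypothesis; its bridge to ONE
SCALE at the lock is landed).  Fix a compact simple `G` with the crux's hypothesis (gap at every
`β > 0` off a locally finite `E`, at every `r`).  ONE SCALE chooses `r`; the landed lock OFF `E` (`lockOffE`) and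
criticality (`criticalOfLock`) give the locked critical datum with UNIFORM; `stub_monomialConstants` turns UNIFORM into ONE
constant per (arity, box); ONE SCALE pins the unit; `stub_volumeChoice` produces the absorbing volume floor and ONE SCALE
responds with volumes above it, the bump and floor ∧ window; the bare scheme on these data carries the lattice gap
(landed) and the monomial bounds at rate `Δ₀ a_k`; the dock anchor — fed U_R, W₂ᴳ (our gap), amnesia by NAME — gives the
Clay `G`-clause. -/
theorem ContinuumFromLatticeGap_of (hXi : DirichletWindow.XiDiverges)
    (hLaw : __Registered.stub_oneScaleLaw)
    (hU : ScalingWindowSplit.SelfNormalisedMomentBoundsR) (hW₂ : ScalingWindowSplit.SelfNormalisedSkewnessGapped)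
    (hA : CoincidenceRotationBootstrap.CurvatureAmnesia) :
    Summit.QuantumFields.YangMills.Theses.GronwallGap.ContinuumFromLatticeGap := by
  -- the six provable reshape-6 stubs are LANDED and used by name (`stub_monomialConstants`, `stub_volumeChoice`,
  -- `stub_clayOfUniformInequalities`; the three RP stubs inside the latter's decay leg); ONE SCALE at the lock is the
  -- theorem `oneScaleCofinal_of_law` of the open reshape-7 stub and the LANDED bridge `stub_lawToCofinal` (p172854)
  have hOne : __Registered.stub_oneScaleCofinal := oneScaleCofinal_of_law hLaw stub_lawToCofinal
  intro G _ _ _ _ hG hgap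
  letI : MeasurableSpace G := borel G
  haveI : BorelSpace G := ⟨rfl⟩
  -- one scale chooses the representation
  obtain ⟨r, hone⟩ := hOne G hG
  -- Step 1 (IR): the lock off the exceptional set, from the crux's hypothesis at `r`, and criticality
  obtain ⟨β, mh, S₁, K, hβ, hmh, hK, hUNIF, hSHARP⟩ := lockOffE hXi G hG r (hgap r)
  have hcrit : Tendsto mh atTop (𝓝 0) := criticalOfLock hXi G hG r β mh S₁ hβ hmh hUNIF
  -- Step 2: ONE constant per (arity, box) from UNIFORM
  obtain ⟨Cmono, hC1, hCmono⟩ := stub_monomialConstants G r β mh S₁ hUNIF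
  -- Step 3 (IR): one scale at the lock — unit and subsequence; then the absorbing volume floor; then volumes ≥ it
  obtain ⟨a, φ, Δ₀, ha, hφ, hΔ₀, hpin, hcof⟩ := hone β mh S₁ K hβ hmh hK hUNIF hSHARP hcrit
  have ha0 : Tendsto a atTop (𝓝 0) := unitToZero a mh φ Δ₀ ha hφ hΔ₀ hpin hcrit
  obtain ⟨L₀, hL₀⟩ := stub_volumeChoice a (fun k => S₁ (φ k)) Cmono ha ha0
  obtain ⟨L, u, p, M, hLL₀, hLS, ⟨N, hN1, hpolyN⟩, hu, hfw⟩ := hcof L₀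
  obtain ⟨-, -, habsL⟩ := hL₀ L hLL₀
  -- the bare scheme on the locked data (anchors `stub_unitToZero`, `stub_bareScheme`, landed)
  have hLt : Tendsto (fun k => a k * (L k : ℝ)) atTop atTop := cscl_tendsto_mul_of_pow hN1 ha ha0 hpolyN
  obtain ⟨sch, hsa, hsβ, hsL, -, -⟩ := bareScheme G a (fun k => β (φ k)) L ha ha0 hLt
  have hw : sch.HasWeakCouplingLimit := by
    show Tendsto sch.β atTop atTop
    rw [show sch.β = fun k => β (φ k) from funext hsβ]
    exact hβ.comp hφ.tendsto_atTop
  have hpv : ∃ N : ℕ, 1 ≤ N ∧ ∀ᶠ k in atTop, (sch.a k)⁻¹ ≤ (sch.a k * (sch.L k : ℝ)) ^ N :=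
    ⟨N, hN1, hpolyN.mono fun k hk => by rw [hsa k, hsL k]; exact hk⟩
  have hpin' : ∀ k, Δ₀ * sch.a k ≤ mh (φ k) := fun k => by rw [hsa k]; exact hpin k
  have hLS' : ∀ k, S₁ (φ k) ≤ sch.L k := fun k => by rw [hsL k]; exact hLS k
  -- Step 4 (IR): the lattice gap along the scheme (landed) and the monomial bounds at rate `Δ₀ a_k`
  have hGAP₀ : HasLatticeMassGap r sch Δ₀ := cclgSplit_gap_of_locked r hUNIF hsβ hpin' hLS'
  have hC0 : ∀ n d, 0 ≤ Cmono n d := fun n d => zero_le_one.trans (hC1 n d)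
  have hmonoS : ∀ (n d : ℕ) (q : Fin n → Fin 4 × Fin 4) (y : Fin n → Site 4),
      (∀ l, (0 ≤ y l 0 ∧ y l 0 ≤ (d : ℤ)) ∧ ∀ i : Fin 4, i ≠ 0 → |y l i| ≤ (d : ℤ)) →
      ∀ (s : Finset (Fin n)) (k j : ℕ), j ≤ sch.L k →
        latticeConnectedCorr r.ρ (sch.β k) (2 * sch.L k + 1)
            ((fun V => ∏ l ∈ s, plane G r (q l) (y l) V) ∘ gaugeTimeReflect)
            (fun V => ∏ l ∈ s, plane G r (q l) (y l) V) j ≤ Cmono n d * Real.exp (-(Δ₀ * sch.a k * j)) := by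
    intro n d q y hy s k j hj
    have h := hCmono n d q y hy s (φ k) (sch.L k) j (hLS' k) hj
    rw [hsβ k]
    refine (le_abs_self _).trans (h.trans ?_)
    refine mul_le_mul_of_nonneg_left (Real.exp_le_exp.2 ?_) (hC0 n d)
    have hj0 : (0 : ℝ) ≤ j := Nat.cast_nonneg j
    nlinarith [hpin' k, hj0]
  have habsS : ∀ n ρ : ℕ, Tendsto (fun k => (Real.log (Cmono n (⌊(ρ : ℝ) / sch.a k⌋₊ + 2)) +
      |Real.log (sch.a k)|) / (sch.a k * (sch.L k : ℝ))) atTop (𝓝 0) := by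
    intro n ρ
    refine (habsL n ρ).congr fun k => ?_
    rw [hsa k, hsL k, max_eq_right (hC1 _ _)]
  -- the floor ∧ window at our scheme
  have hfw' := hfw sch hsa hsβ hsL _ (fun _ _ => rfl)
  -- Steps 5–6 (UV/NG → OS): the dock's core over the UNIFORM-monomial hypotheses — U_R, W₂ᴳ, amnesia by name
  exact stub_clayOfUniformInequalities G hG hU hW₂ hA r sch u p M Δ₀ Cmono _ (fun _ _ => rfl) hw hpv hΔ₀ hGAP₀ hC1
    hmonoS habsS hu hfw'

/-- Signature match: the registered stubs instantiate the hypotheses of the composition (kernel-checked; this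
`example` is the only place the sorried stub is consumed; `XiDiverges`, U_R, W₂ᴳ and `CurvatureAmnesia` stay
named hypotheses = ledger items stmt-8941, stmt-18014, stmt-18170, stmt-16192). -/
example (hXi : DirichletWindow.XiDiverges) (hU : ScalingWindowSplit.SelfNormalisedMomentBoundsR)
    (hW₂ : ScalingWindowSplit.SelfNormalisedSkewnessGapped) (hA : CoincidenceRotationBootstrap.CurvatureAmnesia) :
    Summit.QuantumFields.YangMills.Theses.GronwallGap.ContinuumFromLatticeGap :=
  ContinuumFromLatticeGap_of hXi stub_oneScaleLaw hU hW₂ hA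

end Summit.QuantumFields.YangMills.Cruxes.ContinuumFromLatticeGap.Registered

end
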